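import Summits.AtomisticToContinuum.BoseEinsteinCondensation.Theorems.BECThomsonPrincipleFibreConductanceCageDefs
import Summits.AtomisticToContinuum.BoseEinsteinCondensation.Theorems.BECThomsonPrincipleFibreFubini
import Summits.AtomisticToContinuum.BoseEinsteinCondensation.Theorems.PuffFloor.Negative.FreeGasModel
import HarnessLib

/-!
# Route `BECThomsonPrinciple`, crux `FibreConductance` (stmt-AtomisticToContinuum-9480),
# line `tagged-path-harnack-cage-moments` — stub `stub_conditionalDensityMoments`:
# the free-gas calibration and the monotonicity in the order

Helper file of the OPEN stub `stub_conditionalDensityMoments : ConditionalDensityMoments`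
(`Theorems/BECThomsonPrincipleFibreConductanceCageDefs.lean`): N-, L-uniform two-sided moments
`∫_{cellN} W·(g^p + g^{-p}) ≤ C L³` of the normalised conditional density `g = L³ψ²` of one particle
given the others, for exact zero-free minimisers at low density.  Nothing here asserts the stub;
what is proved is its formal audit:

* **§1–2 The free gas (`v = 0`) — the statement HOLDS and its constant is PINNED at `C = 2`.**
  Every free exact minimiser (`periodicEnergy 0 Φ = E₀^per(0) = 0`) has zero kinetic energy, hence is
  constant on the cell (`exists_eq_const_of_kinetic_zero` of `PuffFloor.Negative.FreeGasModel`: mean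
  value theorem on the open box + continuity along the inward diagonal — the "§G3" step the Disproof
  work file left informal); for a state constant on the cell `W = ‖c‖²L³`, `L³ψ² = 1` on the cell
  (`fibreW_of_eqOn_const`, `condDensity_of_eqOn_const`), so the moment integral EQUALS `2L³` at every
  order (`lintegral_condMoments_freeMinimiser`).  Hence the body of `ConditionalDensityMoments` read
  at `v = 0` holds with `ρ₀ = 1`, `C = 2`, `N₀ = 0` (`conditionalDensityMoments_holds_at_freeGas`),
  and conversely any constant valid at `v = 0` is `≥ 2` (`two_le_of_condMoments_at_freeGas`, witness:
  the constant state).  No junk: `p : ℕ`, `ψ > 0`, `(L³ψ²)⁻¹` honest; the prefix `N ≤ ρ₀L³` allows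
  `N` fixed, `L → ∞`, where free minimisers are still constants.
* **§3 Monotonicity in the order.**  `x^{p'} + x^{-p'} ≤ 2 + x^p + x^{-p}` for `x > 0`, `p' ≤ p`
  (`pow_add_inv_pow_le_two_add`), so `∫W·(g^{p'} + g^{-p'}) ≤ 2L³ + ∫W·(g^p + g^{-p})`
  (`lintegral_condMoments_mono`, using `∫_{cellN} W = L³`), and from `ConditionalDensityMoments` ONE
  triple `(ρ₀, C + 2, N₀)` serves all orders `p' ≤ p` at once
  (`conditionalDensityMoments_uniform_order`) — the bookkeeping the consumer
  `stub_flatteningOfMoments` (orders `12` and `6`) needs.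

References: the line card `Cruxes/FibreConductance/Lines/tagged-path-harnack-cage-moments.md`;
L. Reatto, G. V. Chester, Phys. Rev. 155 (1967) 88 (long-range Jastrow correlations of the Bose
ground state — the physics of `g`; no N-uniform moment bound of this kind is in print).
-/

noncomputable section

namespace Summit.AtomisticToContinuum.BoseEinsteinCondensation.Cruxes.FibreConductance.TaggedPathHarnack

open MeasureTheory
open scoped ENNReal
open Literature.MathematicalPhysics.QuantumManyBody.BoseGas
open Summit.AtomisticToContinuum.BoseEinsteinCondensation.Cruxes.FibreConductance.ParsevalShellBootstrap
open Summit.AtomisticToContinuum.BoseEinsteinCondensation.Theorems.PuffFloor.Negative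
  (exists_eq_const_of_kinetic_zero norm_sq_mul_vol_eq_one)

variable {m : ℕ} {L : ℝ}

/-! ### §1 Fibre data of a state that is constant on the cell -/

/-- Moving the fibre variable inside the cell keeps a cell configuration in the cell. [folklore] -/
theorem update_mem_cellN {X : Config (m + 1)} (hX : X ∈ cellN (m + 1) L) {y : Space}
    (hy : y ∈ cell L) : Function.update X 0 y ∈ cellN (m + 1) L := by
  intro i
  rcases eq_or_ne i 0 with rfl | hi
  · simpa using hy
  · simpa [hi] using hX i

/-- Bath weight of a state constant on the cell: `W = ‖c‖² L³` on the cell. [folklore] -/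
theorem fibreW_of_eqOn_const (hL : 0 < L) (Φ : PeriodicTrialState (m + 1) L) {c : ℂ}
    (hc : ∀ X ∈ cellN (m + 1) L, Φ.ψ X = c) {X : Config (m + 1)} (hX : X ∈ cellN (m + 1) L) :
    fibreW Φ X = ‖c‖ ^ 2 * L ^ 3 := by
  have h : Set.EqOn (fun y => ‖Φ.ψ (Function.update X 0 y)‖ ^ 2) (fun _ => ‖c‖ ^ 2) (cell L) :=
    fun y hy => by simp only [hc _ (update_mem_cellN hX hy)]
  unfold fibreW
  rw [setIntegral_congr_fun (measurableSet_cell L) h, setIntegral_const, measureReal_def,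
    volume_cell, ← ENNReal.ofReal_pow hL.le, ENNReal.toReal_ofReal (by positivity), smul_eq_mul,
    mul_comm]

/-- A state constant on the cell has a non-zero constant (`‖c‖²L^{3N} = 1`). [folklore] -/
theorem norm_pos_of_eqOn_const (hL : 0 < L) (Φ : PeriodicTrialState (m + 1) L) {c : ℂ}
    (hc : ∀ X ∈ cellN (m + 1) L, Φ.ψ X = c) : 0 < ‖c‖ := by
  have hcn : ‖c‖ ^ 2 * (L ^ 3) ^ (m + 1) = 1 := norm_sq_mul_vol_eq_one hL Φ hc
  refine (norm_nonneg c).lt_of_ne fun h => ?_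
  rw [← h] at hcn
  simp at hcn

/-- Normalised conditional density of a state constant on the cell: `g = L³ψ² = 1` on the cell.
[folklore] -/
theorem condDensity_of_eqOn_const (hL : 0 < L) (Φ : PeriodicTrialState (m + 1) L) {c : ℂ}
    (hc : ∀ X ∈ cellN (m + 1) L, Φ.ψ X = c) {X : Config (m + 1)} (hX : X ∈ cellN (m + 1) L) :
    L ^ 3 * fibrePsi Φ X ^ 2 = 1 := by
  have hc0 : ‖c‖ ≠ 0 := (norm_pos_of_eqOn_const hL Φ hc).ne'
  have hL3 : 0 < L ^ 3 := by positivity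
  rw [fibrePsi, fibreW_of_eqOn_const hL Φ hc hX, hc X hX, div_pow,
    Real.sq_sqrt (by positivity)]
  field_simp

/-- The moment integrand of a state constant on the cell is the constant `2‖c‖²L³`. [folklore] -/
theorem condMomentsIntegrand_of_eqOn_const (hL : 0 < L) (p : ℕ) (Φ : PeriodicTrialState (m + 1) L)
    {c : ℂ} (hc : ∀ X ∈ cellN (m + 1) L, Φ.ψ X = c) {X : Config (m + 1)}
    (hX : X ∈ cellN (m + 1) L) :
    fibreW Φ X * ((L ^ 3 * fibrePsi Φ X ^ 2) ^ p + ((L ^ 3 * fibrePsi Φ X ^ 2)⁻¹) ^ p) =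
      2 * (‖c‖ ^ 2 * L ^ 3) := by
  rw [condDensity_of_eqOn_const hL Φ hc hX, fibreW_of_eqOn_const hL Φ hc hX, one_pow, inv_one,
    one_pow]
  ring

/-- **Constant-state instance**: for a state constant on the cell the moment integral of
`ConditionalDensityMoments` EQUALS `2L³`, at every order `p`. [folklore] -/
theorem lintegral_condMoments_of_eqOn_const (hL : 0 < L) (p : ℕ) (Φ : PeriodicTrialState (m + 1) L)
    {c : ℂ} (hc : ∀ X ∈ cellN (m + 1) L, Φ.ψ X = c) :
    ∫⁻ X in cellN (m + 1) L,
        ENNReal.ofReal (fibreW Φ X *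
          ((L ^ 3 * fibrePsi Φ X ^ 2) ^ p + ((L ^ 3 * fibrePsi Φ X ^ 2)⁻¹) ^ p)) =
      ENNReal.ofReal (2 * L ^ 3) := by
  have hcn : ‖c‖ ^ 2 * (L ^ 3) ^ (m + 1) = 1 := norm_sq_mul_vol_eq_one hL Φ hc
  have h : Set.EqOn (fun X => ENNReal.ofReal (fibreW Φ X *
        ((L ^ 3 * fibrePsi Φ X ^ 2) ^ p + ((L ^ 3 * fibrePsi Φ X ^ 2)⁻¹) ^ p)))
      (fun _ => ENNReal.ofReal (2 * (‖c‖ ^ 2 * L ^ 3))) (cellN (m + 1) L) :=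
    fun X hX => by simp only [condMomentsIntegrand_of_eqOn_const hL p Φ hc hX]
  rw [setLIntegral_congr_fun (measurableSet_cellN (m + 1) L) h, setLIntegral_const, volume_cellN,
    ← ENNReal.ofReal_pow hL.le, ← ENNReal.ofReal_pow (by positivity),
    ← ENNReal.ofReal_mul (by positivity)]
  congr 1
  calc 2 * (‖c‖ ^ 2 * L ^ 3) * (L ^ 3) ^ (m + 1) = 2 * L ^ 3 * (‖c‖ ^ 2 * (L ^ 3) ^ (m + 1)) := by
        ring
    _ = 2 * L ^ 3 := by rw [hcn, mul_one]

/-! ### §2 The free gas: every exact minimiser is constant on the cell; the value `2L³` is pinned -/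

/-- **Free exact minimisers are constant on the cell**: at `v = 0` the ground-state energy is `0`,
so an exact minimiser has zero kinetic energy on the cell and is constant there (mean value theorem
on the open box, continuity up to the half-open boundary). [folklore] -/
theorem exists_eqOn_const_of_freeMinimiser (hL : 0 < L) (Φ : PeriodicTrialState (m + 1) L)
    (hE : periodicEnergy 0 Φ = periodicGroundStateEnergy 0 (m + 1) L) :
    ∃ c : ℂ, ∀ X ∈ cellN (m + 1) L, Φ.ψ X = c := by
  -- adapted from PuffFloor/Negative/FreeGasModel.lean (`structureFactor_eq_one_of_freeMinimiser`)
  have h0 : ∫⁻ X in cellN (m + 1) L, kineticDensity Φ.ψ X = 0 := by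
    rw [periodicGroundStateEnergy_zero_eq_zero (m + 1) hL, periodicEnergy] at hE
    rw [← hE]
    refine lintegral_congr fun X => ?_
    rw [periodicInteraction_zeroPotential, zero_mul, add_zero]
  exact exists_eq_const_of_kinetic_zero hL (Nat.succ_pos m) Φ h0

/-- **Free calibration of `ConditionalDensityMoments`**: for every free exact minimiser the
moment integral EQUALS `2L³` at every order `p` (`g ≡ 1`, `∫_{cellN} W = L³`). [folklore] -/
theorem lintegral_condMoments_freeMinimiser (hL : 0 < L) (p : ℕ) (Φ : PeriodicTrialState (m + 1) L)
    (hE : periodicEnergy 0 Φ = periodicGroundStateEnergy 0 (m + 1) L) :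
    ∫⁻ X in cellN (m + 1) L,
        ENNReal.ofReal (fibreW Φ X *
          ((L ^ 3 * fibrePsi Φ X ^ 2) ^ p + ((L ^ 3 * fibrePsi Φ X ^ 2)⁻¹) ^ p)) =
      ENNReal.ofReal (2 * L ^ 3) := by
  obtain ⟨c, hc⟩ := exists_eqOn_const_of_freeMinimiser hL Φ hE
  exact lintegral_condMoments_of_eqOn_const hL p Φ hc

/-- **`ConditionalDensityMoments` read at the free gas HOLDS**, with `ρ₀ = 1`, `C = 2`, `N₀ = 0`,
at every order `p` and for EVERY free exact minimiser (not only the constant state one writes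
down: they are all constant on the cell).  The zero-free hypothesis is not used. [folklore] -/
theorem conditionalDensityMoments_holds_at_freeGas :
    ∀ p : ℕ, ∃ ρ₀ C : ℝ, 0 < ρ₀ ∧ 0 < C ∧ ∃ N₀ : ℕ, ∀ m : ℕ, N₀ ≤ m + 1 →
      ∀ L : ℝ, 0 < L → ((m + 1 : ℕ) : ℝ) ≤ ρ₀ * L ^ 3 →
        ∀ Φ : PeriodicTrialState (m + 1) L,
          periodicEnergy 0 Φ = periodicGroundStateEnergy 0 (m + 1) L → (∀ X, Φ.ψ X ≠ 0) →
            ∫⁻ X in cellN (m + 1) L,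
                ENNReal.ofReal (fibreW Φ X *
                  ((L ^ 3 * fibrePsi Φ X ^ 2) ^ p + ((L ^ 3 * fibrePsi Φ X ^ 2)⁻¹) ^ p)) ≤
              ENNReal.ofReal (C * L ^ 3) :=
  fun p => ⟨1, 2, one_pos, two_pos, 0, fun _ _ _ hL _ Φ hE _ =>
    (lintegral_condMoments_freeMinimiser hL p Φ hE).le⟩

/-- **The free value is pinned: any constant valid at `v = 0` is `≥ 2`.**  If the conclusion of
`ConditionalDensityMoments` holds at `v = 0` at some order `p` with constants `ρ₀ > 0`, `C`, `N₀`,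
then `2 ≤ C` — witness: the constant state of `N ≥ N₀` particles on a torus of side `L` with
`N ≤ ρ₀L³`, an exact zero-free free minimiser whose moment integral is `2L³`. [folklore] -/
theorem two_le_of_condMoments_at_freeGas {p : ℕ} {ρ₀ C : ℝ} (hρ₀ : 0 < ρ₀) {N₀ : ℕ}
    (h : ∀ m : ℕ, N₀ ≤ m + 1 → ∀ L : ℝ, 0 < L → ((m + 1 : ℕ) : ℝ) ≤ ρ₀ * L ^ 3 →
      ∀ Φ : PeriodicTrialState (m + 1) L,
        periodicEnergy 0 Φ = periodicGroundStateEnergy 0 (m + 1) L → (∀ X, Φ.ψ X ≠ 0) →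
          ∫⁻ X in cellN (m + 1) L,
              ENNReal.ofReal (fibreW Φ X *
                ((L ^ 3 * fibrePsi Φ X ^ 2) ^ p + ((L ^ 3 * fibrePsi Φ X ^ 2)⁻¹) ^ p)) ≤
            ENNReal.ofReal (C * L ^ 3)) :
    2 ≤ C := by
  -- `N = N₀ + 1` particles, side `L = 1 + N/ρ₀` (so `N ≤ ρ₀L ≤ ρ₀L³`)
  set m : ℕ := N₀ with hm
  set N : ℝ := ((m + 1 : ℕ) : ℝ) with hN
  have hN1 : (1 : ℝ) ≤ N := by rw [hN]; exact_mod_cast Nat.succ_le_succ (Nat.zero_le m)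
  set L : ℝ := 1 + N / ρ₀ with hL
  have hNρ : 0 ≤ N / ρ₀ := by positivity
  have hL1 : 1 ≤ L := by linarith
  have hLpos : 0 < L := by linarith
  have hdens : N ≤ ρ₀ * L ^ 3 := by
    have h1 : N ≤ ρ₀ * L := by
      rw [hL, mul_add, mul_one, mul_div_cancel₀ _ hρ₀.ne']; linarith [hρ₀.le]
    have h2 : ρ₀ * L ≤ ρ₀ * L ^ 3 := by
      apply mul_le_mul_of_nonneg_left _ hρ₀.le
      nlinarith [hL1, sq_nonneg L]
    linarith
  clear_value L
  have hL3 : 0 < L ^ 3 := by positivity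
  have hV : 0 < (L ^ 3) ^ (m + 1) := by positivity
  -- the constant state
  set c : ℝ := (Real.sqrt ((L ^ 3) ^ (m + 1)))⁻¹ with hc
  have hcpos : 0 < c := by positivity
  have hc2 : c ^ 2 * (L ^ 3) ^ (m + 1) = 1 := by
    rw [hc, inv_pow, Real.sq_sqrt hV.le, inv_mul_cancel₀ hV.ne']
  have hcc : ((‖(c : ℂ)‖₊ : ℝ≥0∞) ^ 2) = ENNReal.ofReal (c ^ 2) := by
    rw [← ENNReal.coe_pow, ENNReal.ofReal, ENNReal.coe_inj]
    ext
    rw [NNReal.coe_pow, coe_nnnorm, Complex.norm_real, Real.norm_of_nonneg hcpos.le,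
      Real.coe_toNNReal _ (by positivity)]
  let Φ : PeriodicTrialState (m + 1) L :=
    { ψ := fun _ => (c : ℂ)
      contDiff := contDiff_const
      periodic := fun _ _ _ => rfl
      symm := fun _ _ => rfl
      norm_eq := by
        rw [setLIntegral_const, volume_cellN, hcc, ← ENNReal.ofReal_pow hLpos.le,
          ← ENNReal.ofReal_pow hL3.le, ← ENNReal.ofReal_mul (by positivity), hc2,
          ENNReal.ofReal_one] }
  -- it is an exact zero-free free minimiser
  have hE : periodicEnergy 0 Φ = periodicGroundStateEnergy 0 (m + 1) L := by
    rw [periodicGroundStateEnergy_zero_eq_zero (m + 1) hLpos]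
    refine (lintegral_congr fun X => ?_).trans lintegral_zero
    rw [periodicInteraction_zeroPotential, zero_mul, add_zero]
    simp [kineticDensity, Φ]
  have hz : ∀ X, Φ.ψ X ≠ 0 := fun X => by
    show (c : ℂ) ≠ 0
    exact_mod_cast hcpos.ne'
  have key := h m (by rw [hm]; exact Nat.le_succ N₀) L hLpos hdens Φ hE hz
  rw [lintegral_condMoments_of_eqOn_const hLpos p Φ (c := (c : ℂ)) (fun _ _ => rfl)] at key
  have key' : 2 * L ^ 3 ≤ C * L ^ 3 := by
    rcases ENNReal.ofReal_le_ofReal_iff'.1 key with h' | h'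
    · exact h'
    · exact absurd h' (not_le.2 (by positivity))
  exact le_of_mul_le_mul_right key' hL3

/-! ### §3 Monotonicity in the order -/

/-- `x^{p'} + x^{-p'} ≤ 2 + (x^p + x^{-p})` for `x > 0` and `p' ≤ p`: the smaller of `x`, `x⁻¹` has
all its powers `≤ 1`, the larger one has increasing powers. [folklore] -/
theorem pow_add_inv_pow_le_two_add {x : ℝ} (hx : 0 < x) {p' p : ℕ} (h : p' ≤ p) :
    x ^ p' + x⁻¹ ^ p' ≤ 2 + (x ^ p + x⁻¹ ^ p) := by
  have hx0 := hx.le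
  have hxi0 : 0 ≤ x⁻¹ := inv_nonneg.2 hx0
  rcases le_total x 1 with hx1 | hx1
  · have h1 : x ^ p' ≤ 1 := pow_le_one₀ hx0 hx1
    have h2 : x⁻¹ ^ p' ≤ x⁻¹ ^ p := pow_le_pow_right₀ ((one_le_inv₀ hx).2 hx1) h
    have h3 : 0 ≤ x ^ p := pow_nonneg hx0 p
    linarith
  · have h1 : x⁻¹ ^ p' ≤ 1 := pow_le_one₀ hxi0 (inv_le_one_of_one_le₀ hx1)
    have h2 : x ^ p' ≤ x ^ p := pow_le_pow_right₀ hx1 h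
    have h3 : 0 ≤ x⁻¹ ^ p := pow_nonneg hxi0 p
    linarith

/-- The moment integrand `W·(g^p + g^{-p})` of a zero-free state is measurable (`W`, `ψ` are
continuous). [folklore] -/
theorem measurable_condMomentsIntegrand (hL : 0 < L) (p : ℕ) (Φ : PeriodicTrialState (m + 1) L)
    (hΦ : ∀ X, Φ.ψ X ≠ 0) :
    Measurable fun X => ENNReal.ofReal (fibreW Φ X *
      ((L ^ 3 * fibrePsi Φ X ^ 2) ^ p + ((L ^ 3 * fibrePsi Φ X ^ 2)⁻¹) ^ p)) := by
  have hg : Measurable fun X => L ^ 3 * fibrePsi Φ X ^ 2 :=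
    ((measurable_fibrePsi hL Φ hΦ).pow_const 2).const_mul _
  exact ((measurable_fibreW Φ).mul ((hg.pow_const p).add (hg.inv.pow_const p))).ennreal_ofReal

/-- Pointwise monotonicity of the moment integrand in the order, in `ℝ≥0∞`:
`W·(g^{p'} + g^{-p'}) ≤ 2W + W·(g^p + g^{-p})` for `p' ≤ p`. [folklore] -/
theorem condMomentsIntegrand_mono (hL : 0 < L) (Φ : PeriodicTrialState (m + 1) L)
    (hΦ : ∀ X, Φ.ψ X ≠ 0) {p' p : ℕ} (h : p' ≤ p) (X : Config (m + 1)) :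
    ENNReal.ofReal (fibreW Φ X *
        ((L ^ 3 * fibrePsi Φ X ^ 2) ^ p' + ((L ^ 3 * fibrePsi Φ X ^ 2)⁻¹) ^ p')) ≤
      ENNReal.ofReal 2 * ENNReal.ofReal (fibreW Φ X) +
        ENNReal.ofReal (fibreW Φ X *
          ((L ^ 3 * fibrePsi Φ X ^ 2) ^ p + ((L ^ 3 * fibrePsi Φ X ^ 2)⁻¹) ^ p)) := by
  have hW := fibreW_nonneg Φ X
  have hg : 0 < L ^ 3 * fibrePsi Φ X ^ 2 := by
    have := fibrePsi_pos hL Φ hΦ X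
    positivity
  have hb : 0 ≤ (L ^ 3 * fibrePsi Φ X ^ 2) ^ p + ((L ^ 3 * fibrePsi Φ X ^ 2)⁻¹) ^ p := by
    positivity
  rw [← ENNReal.ofReal_mul zero_le_two, ← ENNReal.ofReal_add (by positivity) (by positivity)]
  refine ENNReal.ofReal_le_ofReal ?_
  calc fibreW Φ X * ((L ^ 3 * fibrePsi Φ X ^ 2) ^ p' + ((L ^ 3 * fibrePsi Φ X ^ 2)⁻¹) ^ p')
      ≤ fibreW Φ X * (2 + ((L ^ 3 * fibrePsi Φ X ^ 2) ^ p + ((L ^ 3 * fibrePsi Φ X ^ 2)⁻¹) ^ p)) :=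
        mul_le_mul_of_nonneg_left (pow_add_inv_pow_le_two_add hg h) hW
    _ = 2 * fibreW Φ X +
          fibreW Φ X * ((L ^ 3 * fibrePsi Φ X ^ 2) ^ p + ((L ^ 3 * fibrePsi Φ X ^ 2)⁻¹) ^ p) := by
        ring

/-- **Monotonicity in the order, integrated**: for a zero-free state and `p' ≤ p`,
`∫_{cellN} W·(g^{p'} + g^{-p'}) ≤ 2L³ + ∫_{cellN} W·(g^p + g^{-p})` (`∫_{cellN} W = L³`). [folklore] -/
theorem lintegral_condMoments_mono (hL : 0 < L) (Φ : PeriodicTrialState (m + 1) L)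
    (hΦ : ∀ X, Φ.ψ X ≠ 0) {p' p : ℕ} (h : p' ≤ p) :
    ∫⁻ X in cellN (m + 1) L,
        ENNReal.ofReal (fibreW Φ X *
          ((L ^ 3 * fibrePsi Φ X ^ 2) ^ p' + ((L ^ 3 * fibrePsi Φ X ^ 2)⁻¹) ^ p')) ≤
      ENNReal.ofReal (2 * L ^ 3) +
        ∫⁻ X in cellN (m + 1) L,
          ENNReal.ofReal (fibreW Φ X *
            ((L ^ 3 * fibrePsi Φ X ^ 2) ^ p + ((L ^ 3 * fibrePsi Φ X ^ 2)⁻¹) ^ p)) := by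
  have hWm : Measurable fun X => ENNReal.ofReal (fibreW Φ X) := (measurable_fibreW Φ).ennreal_ofReal
  calc ∫⁻ X in cellN (m + 1) L,
          ENNReal.ofReal (fibreW Φ X *
            ((L ^ 3 * fibrePsi Φ X ^ 2) ^ p' + ((L ^ 3 * fibrePsi Φ X ^ 2)⁻¹) ^ p'))
      ≤ ∫⁻ X in cellN (m + 1) L, (ENNReal.ofReal 2 * ENNReal.ofReal (fibreW Φ X) +
          ENNReal.ofReal (fibreW Φ X *
            ((L ^ 3 * fibrePsi Φ X ^ 2) ^ p + ((L ^ 3 * fibrePsi Φ X ^ 2)⁻¹) ^ p))) :=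
        lintegral_mono (condMomentsIntegrand_mono hL Φ hΦ h)
    _ = (ENNReal.ofReal 2 * ∫⁻ X in cellN (m + 1) L, ENNReal.ofReal (fibreW Φ X)) +
          ∫⁻ X in cellN (m + 1) L, ENNReal.ofReal (fibreW Φ X *
            ((L ^ 3 * fibrePsi Φ X ^ 2) ^ p + ((L ^ 3 * fibrePsi Φ X ^ 2)⁻¹) ^ p)) := by
        rw [lintegral_add_left (hWm.const_mul _), lintegral_const_mul _ hWm]
    _ = _ := by rw [lintegral_cellN_fibreW hL Φ, ← ENNReal.ofReal_mul zero_le_two]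

/-- **One set of constants for all lower orders** (bookkeeping for the consumer
`stub_flatteningOfMoments`, which uses the orders `12` and `6`): from `ConditionalDensityMoments`,
for every `v` and every order `p` a SINGLE triple `(ρ₀, C, N₀)` bounds the moments at every order
`p' ≤ p` — the triple of order `p` with `2` added to its constant. [folklore] -/
theorem conditionalDensityMoments_uniform_order (hCDM : ConditionalDensityMoments) :
    ∀ v : ℝ → ℝ≥0∞, IsRepulsiveFiniteRange v → (∃ B : ℝ, ∀ r, v r ≤ ENNReal.ofReal B) →
      ∀ p : ℕ, ∃ ρ₀ C : ℝ, 0 < ρ₀ ∧ 0 < C ∧ ∃ N₀ : ℕ, ∀ p' : ℕ, p' ≤ p → ∀ m : ℕ, N₀ ≤ m + 1 →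
        ∀ L : ℝ, 0 < L → ((m + 1 : ℕ) : ℝ) ≤ ρ₀ * L ^ 3 →
          ∀ Φ : PeriodicTrialState (m + 1) L,
            periodicEnergy v Φ = periodicGroundStateEnergy v (m + 1) L → (∀ X, Φ.ψ X ≠ 0) →
              ∫⁻ X in cellN (m + 1) L,
                  ENNReal.ofReal (fibreW Φ X *
                    ((L ^ 3 * fibrePsi Φ X ^ 2) ^ p' + ((L ^ 3 * fibrePsi Φ X ^ 2)⁻¹) ^ p')) ≤
                ENNReal.ofReal (C * L ^ 3) := by
  intro v hv hB p
  obtain ⟨ρ₀, C, hρ₀, hC, N₀, h⟩ := hCDM v hv hB p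
  refine ⟨ρ₀, C + 2, hρ₀, by positivity, N₀, fun p' hp' m hm L hL hρ Φ hE hz => ?_⟩
  calc ∫⁻ X in cellN (m + 1) L,
          ENNReal.ofReal (fibreW Φ X *
            ((L ^ 3 * fibrePsi Φ X ^ 2) ^ p' + ((L ^ 3 * fibrePsi Φ X ^ 2)⁻¹) ^ p'))
      ≤ ENNReal.ofReal (2 * L ^ 3) +
          ∫⁻ X in cellN (m + 1) L,
            ENNReal.ofReal (fibreW Φ X *
              ((L ^ 3 * fibrePsi Φ X ^ 2) ^ p + ((L ^ 3 * fibrePsi Φ X ^ 2)⁻¹) ^ p)) :=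
        lintegral_condMoments_mono hL Φ hz hp'
    _ ≤ ENNReal.ofReal (2 * L ^ 3) + ENNReal.ofReal (C * L ^ 3) :=
        add_le_add le_rfl (h m hm L hL hρ Φ hE hz)
    _ = ENNReal.ofReal ((C + 2) * L ^ 3) := by
        rw [← ENNReal.ofReal_add (by positivity) (by positivity)]
        congr 1
        ring

end Summit.AtomisticToContinuum.BoseEinsteinCondensation.Cruxes.FibreConductance.TaggedPathHarnack

end
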